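import Mathlib
import Literature.NumberTheory.Automorphic.EisensteinOrthogonality

/-!
# The `x`-constant and oscillating parts of the lattice theta function; the entire function `N(z, s)`
(Iwaniec, *Spectral Methods of Automorphic Forms*, GSM 53, §3.4 (3.20), Theorem 3.4 (3.29), PDF pp. 45–47)

Layer 25a of the `provefact` decomposition of `Literature.NumberTheory.Automorphic.sl2BallCount_asymp`
(`HyperbolicLatticeCount.lean`), continuing the continuous-spectrum part of the spectral theorem for
`L²(SL₂(ℤ)\ℍ)` behind `Iwaniec2002_thm_7_4_modular` (`ModularPretrace.lean`).

The Fourier expansion (3.29) of `E(z, s)` (constant term `y^s + φ(s) y^{1-s}`, then `K`-Bessel terms)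
is obtained in the book from the Bruhat decomposition and (3.17)–(3.20). In this tree `E(z, s)` is
Riemann's continuation `E*(z, s)/Λ(2s)`, `E*(z, s) = ½ Λ_z(s)` the Mellin transform of the theta
series `Θ_z(t)` of the lattice `ℤz + ℤ` (`ModularEisensteinContinuation.lean`). The `x`-Poisson
formula already proved there, `Θ_z(t) = √(y/t) Σ_{(m,k) ∈ ℤ²} e^{-π y t m²} e^{-π y k²/t} e(-x m k)`
(`thetaQ_eq_sqrt_mul_tsum`), splits `Θ_z` into the terms with `mk = 0`, which do not depend on
`x = Re z` — the **constant part** `Θ⁰_z(t) = √(y/t)(θ(yt) + θ(y/t) - 1)`, `θ(u) = Σ_n e^{-π u n²}` —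
and the **oscillating part** `Θ♯_z(t) = √(y/t) Σ_{m ≠ 0, k ≠ 0} (…)`. This file proves everything
about this splitting that the constant-term formula and the cusp estimates of the next layer need.
Everything here is proved; nothing is vendored.

1. `thetaZ u = θ(u)`: positivity, monotonicity, Jacobi `θ(1/u) = √u θ(u)`, the tail bound
   `θ(u) - 1 ≤ e^{-π(u - u₀)}(θ(u₀) - 1)` (`u ≥ u₀`), continuity on `(0, ∞)`.
2. `thetaConst z t = Θ⁰_z(t)`, `thetaNC z t = Θ♯_z(t) := Θ_z(t) - Θ⁰_z(t)` and the representation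
   `Θ♯_z(t) = √(y/t) Σ_{m ≠ 0 ≠ k} dTerm` (`thetaNC_eq_sqrt_mul_tsum`); hence the clean bound
   `‖Θ♯_z(t)‖ ≤ √(y/t)(θ(yt) - 1)(θ(y/t) - 1)`, the functional equation `Θ♯_z(1/t) = t Θ♯_z(t)`,
   and the vanishing of the horizontal mean `∫₀¹ Θ♯_{x+iy}(t) dx = 0`.
3. Decay: `‖Θ♯_z(t)‖ ≤ K(y) e^{-π y t}` for `t ≥ 1` with `K(y) = e^{πy}(θ(y) - 1)θ(1/y) ≤ K₁ √y`
   (`y ≥ 1/2`), and `‖Θ♯_z(t)‖ ≤ K(y) t⁻¹ e^{-π y/t}` for `t ≤ 1`; so `Θ♯_z` is `O(e^{-πyt})` at `∞`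
   and `O(t^{-b})` at `0` for every `b`, and its Mellin transform converges everywhere.
4. **`eisN z s = N(z, s) := ½ ∫₀^∞ Θ♯_z(t) t^{s-1} dt`** is entire in `s`, has horizontal mean zero,
   and satisfies `‖N(z, s)‖ ≤ ½ K(y) ∫₁^∞ e^{-πyt}(t^{σ-1} + t^{-σ}) dt` — exponentially small in the
   cusp, uniformly in `t = Im s`. (In the book `N(z, s)` is the sum of the `K`-Bessel terms of (3.29)
   times `θ(s)`; we never need the Bessel functions themselves.)

Mathlib: `Real.tsum_exp_neg_mul_int_sq` (Jacobi), `HurwitzZeta.continuousOn_evenKernel`,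
`Function.Injective.hasSum_iff`, `tsum_mul_tsum_of_summable_norm`, `integral_exp_mul_complex`,
`integral_comp_rpow_Ioi`, `mellin_differentiableAt_of_isBigO_rpow_exp`, `integrable_of_isBigO_exp_neg`,
`Real.pow_div_factorial_le_exp`. Literature: `thetaQ`, `dTerm`, `thetaQ_eq_sqrt_mul_tsum`,
`thetaQ_functional_equation`, `continuousAt_thetaQ`, `summable_exp_neg_mul_int_sq`, `sqrt_mul_eq`
(`ModularEisensteinContinuation.lean`); `pt` (`HyperbolicDirichletForm.lean`).

## References
* [Iwaniec2002] H. Iwaniec, *Spectral Methods of Automorphic Forms*, 2nd ed., GSM 53, AMS 2002,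
  §3.4 (3.20), Thm 3.4 (3.29), PDF pp. 45–47.
-/

noncomputable section

namespace Literature.NumberTheory.Automorphic

open MeasureTheory Set Filter Real UpperHalfPlane
open scoped Topology

/-! ## 1. The one-variable theta function `θ(u) = Σ_n e^{-π u n²}` -/

/-- `θ(u) = Σ_{n ∈ ℤ} e^{-π u n²}` (`u > 0`), the theta function of the lattice `ℤ`. [folklore] -/
def thetaZ (u : ℝ) : ℝ := ∑' n : ℤ, Real.exp (-π * u * (n : ℝ) ^ 2)

/-- Summability of the Gaussian over `ℤ` in the form `e^{-π u n²}`. [folklore] -/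
theorem summable_thetaZ_term {u : ℝ} (hu : 0 < u) :
    Summable fun n : ℤ => Real.exp (-π * u * (n : ℝ) ^ 2) := by
  have h := summable_exp_neg_mul_int_sq (a := π * u) (by positivity)
  refine h.congr fun n => ?_
  ring_nf

/-- `HasSum` form of the definition of `θ`. [folklore] -/
theorem hasSum_thetaZ {u : ℝ} (hu : 0 < u) :
    HasSum (fun n : ℤ => Real.exp (-π * u * (n : ℝ) ^ 2)) (thetaZ u) :=
  (summable_thetaZ_term hu).hasSum

/-- The tail `θ(u) - 1 = Σ_{n ≠ 0} e^{-π u n²}` as a `HasSum`. [folklore] -/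
theorem hasSum_thetaZ_sub_one {u : ℝ} (hu : 0 < u) :
    HasSum (fun n : ℤ => if n = 0 then 0 else Real.exp (-π * u * (n : ℝ) ^ 2)) (thetaZ u - 1) := by
  have h := hasSum_ite_sub_hasSum (hasSum_thetaZ hu) 0
  simpa using h

/-- `θ(u) ≥ 1`. [folklore] -/
theorem one_le_thetaZ {u : ℝ} (hu : 0 < u) : 1 ≤ thetaZ u := by
  have h := (hasSum_thetaZ_sub_one hu).nonneg fun n => by
    split_ifs <;> [exact le_rfl; exact (Real.exp_pos _).le]
  linarith

/-- `θ(u) > 0`. [folklore] -/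
theorem thetaZ_pos {u : ℝ} (hu : 0 < u) : 0 < thetaZ u := one_pos.trans_le (one_le_thetaZ hu)

/-- `θ` is decreasing on `(0, ∞)`. [folklore] -/
theorem thetaZ_antitoneOn : AntitoneOn thetaZ (Ioi 0) := by
  intro a ha b hb hab
  refine (summable_thetaZ_term hb).tsum_le_tsum (fun n => ?_) (summable_thetaZ_term ha)
  refine Real.exp_le_exp.mpr ?_
  have : 0 ≤ π * (n : ℝ) ^ 2 := by positivity
  nlinarith

/-- **Jacobi's transformation formula** `θ(u) = u^{-1/2} θ(1/u)`. [folklore] -/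
theorem thetaZ_eq_rpow_mul_thetaZ_inv {u : ℝ} (hu : 0 < u) :
    thetaZ u = u ^ (-(1 / 2 : ℝ)) * thetaZ (1 / u) := by
  unfold thetaZ
  rw [Real.tsum_exp_neg_mul_int_sq hu, Real.rpow_neg hu.le, one_div (u ^ _)]
  congr 1
  refine tsum_congr fun n => ?_
  congr 1
  field_simp

/-- Jacobi in the form `θ(1/u) = √u θ(u)`. [folklore] -/
theorem thetaZ_inv {u : ℝ} (hu : 0 < u) : thetaZ (1 / u) = Real.sqrt u * thetaZ u := by
  rw [thetaZ_eq_rpow_mul_thetaZ_inv hu, Real.sqrt_eq_rpow, ← mul_assoc, ← Real.rpow_add hu]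
  norm_num

/-- **Exponential decay of the tail**: `θ(u) - 1 ≤ e^{-π (u - u₀)} (θ(u₀) - 1)` for `u ≥ u₀ > 0`. [folklore] -/
theorem thetaZ_sub_one_le {u₀ u : ℝ} (hu₀ : 0 < u₀) (hu : u₀ ≤ u) :
    thetaZ u - 1 ≤ Real.exp (-(π * (u - u₀))) * (thetaZ u₀ - 1) := by
  have hupos : 0 < u := hu₀.trans_le hu
  have h1 := hasSum_thetaZ_sub_one hupos
  have h0 := (hasSum_thetaZ_sub_one hu₀).mul_left (Real.exp (-(π * (u - u₀))))
  refine hasSum_le (fun n => ?_) h1 h0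
  split_ifs with hn
  · simp
  · rw [← Real.exp_add]
    refine Real.exp_le_exp.mpr ?_
    have hn1 : (1 : ℝ) ≤ (n : ℝ) ^ 2 := by
      have : (1 : ℤ) ≤ n ^ 2 := by
        have := Int.one_le_abs hn
        nlinarith [sq_abs n]
      exact_mod_cast this
    have : 0 ≤ π * (u - u₀) := by have := Real.pi_pos; nlinarith
    nlinarith [Real.pi_pos]

/-- `θ(v) - 1 ≤ √(w/v) θ(1/w)`-type bound for small arguments: for `0 < v` and `v ≤ w`,
`θ(v) ≤ √(w/v)·… `; we use the special form `θ(y/t) ≤ √(t/y) θ(1/y)` for `t ≥ 1`. [folklore] -/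
theorem thetaZ_div_le {y t : ℝ} (hy : 0 < y) (ht : 1 ≤ t) :
    thetaZ (y / t) ≤ Real.sqrt (t / y) * thetaZ (1 / y) := by
  have htpos : 0 < t := one_pos.trans_le ht
  have hv : 0 < y / t := div_pos hy htpos
  have h1 : thetaZ (y / t) = Real.sqrt (t / y) * thetaZ (t / y) := by
    have := thetaZ_inv (u := t / y) (div_pos htpos hy)
    rw [one_div_div] at this
    exact this
  rw [h1]
  refine mul_le_mul_of_nonneg_left ?_ (Real.sqrt_nonneg _)
  refine thetaZ_antitoneOn (one_div_pos.mpr hy) (div_pos htpos hy) ?_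
  rw [div_le_div_iff_of_pos_right hy]; exact ht

/-- Continuity of `θ` on `(0, ∞)` (it is Mathlib's even Hurwitz kernel at `a = 0`). [folklore] -/
theorem continuousOn_thetaZ : ContinuousOn thetaZ (Ioi 0) := by
  have h : EqOn thetaZ (HurwitzZeta.evenKernel ((0 : ℝ) : UnitAddCircle)) (Ioi 0) := by
    intro t ht
    have h1 := HurwitzZeta.hasSum_int_evenKernel 0 (mem_Ioi.mp ht)
    simp only [add_zero] at h1
    rw [← h1.tsum_eq]
    unfold thetaZ
    refine tsum_congr fun n => ?_
    ring_nf
  exact (HurwitzZeta.continuousOn_evenKernel _).congr h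

/-! ## 2. The constant and oscillating parts of `Θ_z` -/

/-- **The `x`-constant part** `Θ⁰_z(t) = √(y/t) (θ(yt) + θ(y/t) - 1)` of the theta series of `ℤz + ℤ`
(the terms with `mk = 0` of the `x`-Poisson formula). [folklore] -/
def thetaConst (z : ℍ) (t : ℝ) : ℝ :=
  Real.sqrt (z.im / t) * (thetaZ (z.im * t) + thetaZ (z.im / t) - 1)

/-- **The oscillating part** `Θ♯_z(t) = Θ_z(t) - Θ⁰_z(t)` (complex-valued for the Mellin calculus). [folklore] -/
def thetaNC (z : ℍ) (t : ℝ) : ℂ := ((thetaQ z t - thetaConst z t : ℝ) : ℂ)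

/-- The oscillating terms: `dTerm` off the coordinate axes. [folklore] -/
def ncTerm (z : ℍ) (t : ℝ) (p : ℤ × ℤ) : ℂ := if p.1 = 0 ∨ p.2 = 0 then 0 else dTerm z t p

/-- The axis terms: `dTerm` on the coordinate axes. [folklore] -/
def axTerm (z : ℍ) (t : ℝ) (p : ℤ × ℤ) : ℂ := if p.1 = 0 ∨ p.2 = 0 then dTerm z t p else 0

/-- The axis and off-axis terms recombine to `dTerm`. [folklore] -/
theorem axTerm_add_ncTerm (z : ℍ) (t : ℝ) (p : ℤ × ℤ) : axTerm z t p + ncTerm z t p = dTerm z t p := by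
  unfold axTerm ncTerm; split_ifs <;> simp

/-- The modulus of an off-axis term is a product of two Gaussians (and `0` on the axes). [folklore] -/
theorem norm_ncTerm (z : ℍ) (t : ℝ) (p : ℤ × ℤ) :
    ‖ncTerm z t p‖ = (if p.1 = 0 then 0 else Real.exp (-(π * z.im * t) * (p.1 : ℝ) ^ 2)) *
      (if p.2 = 0 then 0 else Real.exp (-(π * z.im / t) * (p.2 : ℝ) ^ 2)) := by
  unfold ncTerm
  by_cases h1 : p.1 = 0
  · simp [h1]
  · by_cases h2 : p.2 = 0
    · simp [h2]
    · rw [if_neg (by tauto), if_neg h1, if_neg h2, norm_dTerm]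

/-- Axis terms are dominated by `dTerm`. [folklore] -/
theorem norm_axTerm_le (z : ℍ) (t : ℝ) (p : ℤ × ℤ) : ‖axTerm z t p‖ ≤ ‖dTerm z t p‖ := by
  unfold axTerm; split_ifs <;> simp

/-- Off-axis terms are dominated by `dTerm`. [folklore] -/
theorem norm_ncTerm_le (z : ℍ) (t : ℝ) (p : ℤ × ℤ) : ‖ncTerm z t p‖ ≤ ‖dTerm z t p‖ := by
  unfold ncTerm; split_ifs <;> simp

/-- Summability of the axis terms. [folklore] -/
theorem summable_axTerm (z : ℍ) {t : ℝ} (ht : 0 < t) : Summable (axTerm z t) :=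
  Summable.of_norm_bounded (summable_dTerm z ht).norm (norm_axTerm_le z t)

/-- Summability of the off-axis terms. [folklore] -/
theorem summable_ncTerm (z : ℍ) {t : ℝ} (ht : 0 < t) : Summable (ncTerm z t) :=
  Summable.of_norm_bounded (summable_dTerm z ht).norm (norm_ncTerm_le z t)

/-- Absolute summability of the off-axis terms. [folklore] -/
theorem summable_norm_ncTerm (z : ℍ) {t : ℝ} (ht : 0 < t) : Summable fun p => ‖ncTerm z t p‖ :=
  Summable.of_nonneg_of_le (fun _ => norm_nonneg _) (norm_ncTerm_le z t) (summable_dTerm z ht).norm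

/-- Complex form of `hasSum_thetaZ`. [folklore] -/
theorem hasSum_thetaZ_complex {u : ℝ} (hu : 0 < u) :
    HasSum (fun n : ℤ => Complex.exp (-(π * u * (n : ℝ) ^ 2) : ℝ)) (thetaZ u : ℂ) := by
  have h := (hasSum_thetaZ hu).mapL Complex.ofRealCLM
  simp only [Complex.ofRealCLM_apply, Complex.ofReal_exp] at h
  refine h.congr_fun fun n => ?_
  push_cast; ring_nf

/-- **The axis terms sum to `θ(yt) + θ(y/t) - 1`.** [folklore] -/
theorem hasSum_axTerm (z : ℍ) {t : ℝ} (ht : 0 < t) :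
    HasSum (axTerm z t) ((thetaZ (z.im * t) + thetaZ (z.im / t) - 1 : ℝ) : ℂ) := by
  have hy := z.im_pos
  -- the three pieces
  set f₁ : ℤ × ℤ → ℂ := fun p => if p.2 = 0 then Complex.exp (-(π * (z.im * t) * (p.1 : ℝ) ^ 2) : ℝ) else 0
  set f₂ : ℤ × ℤ → ℂ := fun p => if p.1 = 0 then Complex.exp (-(π * (z.im / t) * (p.2 : ℝ) ^ 2) : ℝ) else 0
  set f₃ : ℤ × ℤ → ℂ := fun p => if p = 0 then 1 else 0
  have hdecomp : ∀ p, axTerm z t p = f₁ p + f₂ p - f₃ p := by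
    rintro ⟨m, k⟩
    by_cases hm : m = 0
    · subst hm
      by_cases hk : k = 0
      · subst hk; simp [axTerm, f₁, f₂, f₃, dTerm]
      · simp only [axTerm, f₁, f₂, f₃, dTerm, hk, true_or, if_true, if_false, Prod.mk_eq_zero, and_false,
          sub_zero, zero_add, Int.cast_zero]
        push_cast
        simp only [mul_zero, zero_mul, neg_zero, Complex.exp_zero, one_mul, mul_one, ne_eq,
          OfNat.ofNat_ne_zero, not_false_eq_true, zero_pow]
        congr 1; ring
    · by_cases hk : k = 0
      · subst hk
        simp only [axTerm, f₁, f₂, f₃, dTerm, hm, or_true, if_true, if_false, Prod.mk_eq_zero, and_true,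
          sub_zero, add_zero, Int.cast_zero]
        push_cast
        simp only [mul_zero, zero_mul, neg_zero, Complex.exp_zero, mul_one, ne_eq,
          OfNat.ofNat_ne_zero, not_false_eq_true, zero_pow]
        congr 1; ring
      · simp [axTerm, f₁, f₂, f₃, hm, hk]
  have h₁ : HasSum f₁ (thetaZ (z.im * t) : ℂ) := by
    have hinj : Function.Injective fun m : ℤ => (m, (0 : ℤ)) := fun a b h => by simpa using h
    have := (Function.Injective.hasSum_iff hinj (f := f₁) (a := (thetaZ (z.im * t) : ℂ)) ?_).mp
    · apply this
      have hc := hasSum_thetaZ_complex (u := z.im * t) (by positivity)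
      refine hc.congr_fun fun m => ?_
      simp [f₁]
    · rintro ⟨m, k⟩ hp
      have hk : k ≠ 0 := by
        rintro rfl; exact hp ⟨m, rfl⟩
      simp [f₁, hk]
  have h₂ : HasSum f₂ (thetaZ (z.im / t) : ℂ) := by
    have hinj : Function.Injective fun k : ℤ => ((0 : ℤ), k) := fun a b h => by simpa using h
    have := (Function.Injective.hasSum_iff hinj (f := f₂) (a := (thetaZ (z.im / t) : ℂ)) ?_).mp
    · apply this
      have hc := hasSum_thetaZ_complex (u := z.im / t) (by positivity)
      refine hc.congr_fun fun k => ?_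
      simp [f₂]
    · rintro ⟨m, k⟩ hp
      have hm : m ≠ 0 := by
        rintro rfl; exact hp ⟨k, rfl⟩
      simp [f₂, hm]
  have h₃ : HasSum f₃ 1 := by
    simpa [f₃] using hasSum_ite_eq (0 : ℤ × ℤ) (1 : ℂ)
  have h := (h₁.add h₂).sub h₃
  have e : axTerm z t = fun p => f₁ p + f₂ p - f₃ p := funext hdecomp
  rw [e]
  have e2 : (((thetaZ (z.im * t) + thetaZ (z.im / t) - 1 : ℝ)) : ℂ) =
      (thetaZ (z.im * t) : ℂ) + (thetaZ (z.im / t) : ℂ) - 1 := by push_cast; ring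
  rw [e2]; exact h

/-- **`Θ♯_z(t) = √(y/t) Σ_{m ≠ 0, k ≠ 0} dTerm(m, k)`** — the oscillating part of the `x`-Poisson
formula. [cite: Iwaniec2002, (3.20), PDF p. 45] -/
theorem thetaNC_eq_sqrt_mul_tsum (z : ℍ) {t : ℝ} (ht : 0 < t) :
    thetaNC z t = (Real.sqrt (z.im / t) : ℂ) * ∑' p : ℤ × ℤ, ncTerm z t p := by
  have h1 := thetaQ_eq_sqrt_mul_tsum z ht
  have h2 : ∑' p : ℤ × ℤ, dTerm z t p = ∑' p, axTerm z t p + ∑' p, ncTerm z t p := by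
    rw [← (summable_axTerm z ht).tsum_add (summable_ncTerm z ht)]
    exact tsum_congr fun p => (axTerm_add_ncTerm z t p).symm
  rw [(hasSum_axTerm z ht).tsum_eq] at h2
  have h3 : (thetaQ z t : ℂ) = (Real.sqrt (z.im / t) : ℂ) *
      (((thetaZ (z.im * t) + thetaZ (z.im / t) - 1 : ℝ) : ℂ) + ∑' p, ncTerm z t p) := by rw [h1, h2]
  unfold thetaNC thetaConst
  push_cast at h3 ⊢
  linear_combination h3

/-- **The product bound** `‖Θ♯_z(t)‖ ≤ √(y/t) (θ(yt) - 1)(θ(y/t) - 1)`. [folklore] -/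
theorem norm_thetaNC_le (z : ℍ) {t : ℝ} (ht : 0 < t) :
    ‖thetaNC z t‖ ≤ Real.sqrt (z.im / t) * ((thetaZ (z.im * t) - 1) * (thetaZ (z.im / t) - 1)) := by
  have hy := z.im_pos
  rw [thetaNC_eq_sqrt_mul_tsum z ht, norm_mul, Complex.norm_real, Real.norm_of_nonneg (Real.sqrt_nonneg _)]
  refine mul_le_mul_of_nonneg_left ?_ (Real.sqrt_nonneg _)
  refine (norm_tsum_le_tsum_norm (summable_norm_ncTerm z ht)).trans (le_of_eq ?_)
  simp_rw [norm_ncTerm]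
  set g₁ : ℤ → ℝ := fun m => if m = 0 then 0 else Real.exp (-(π * z.im * t) * (m : ℝ) ^ 2)
  set g₂ : ℤ → ℝ := fun k => if k = 0 then 0 else Real.exp (-(π * z.im / t) * (k : ℝ) ^ 2)
  have hg₁ : HasSum g₁ (thetaZ (z.im * t) - 1) := by
    have := hasSum_thetaZ_sub_one (u := z.im * t) (by positivity)
    refine this.congr_fun fun m => ?_
    simp only [g₁]; split_ifs <;> [rfl; (congr 1; ring)]
  have hg₂ : HasSum g₂ (thetaZ (z.im / t) - 1) := by
    have := hasSum_thetaZ_sub_one (u := z.im / t) (by positivity)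
    refine this.congr_fun fun k => ?_
    simp only [g₂]; split_ifs <;> [rfl; (congr 1; ring)]
  have hn₁ : ∀ m, 0 ≤ g₁ m := fun m => by simp only [g₁]; split_ifs <;> [exact le_rfl; exact (Real.exp_pos _).le]
  have hn₂ : ∀ k, 0 ≤ g₂ k := fun k => by simp only [g₂]; split_ifs <;> [exact le_rfl; exact (Real.exp_pos _).le]
  have hprod : HasSum (fun p : ℤ × ℤ => g₁ p.1 * g₂ p.2) ((thetaZ (z.im * t) - 1) * (thetaZ (z.im / t) - 1)) :=
    hg₁.mul hg₂ (summable_mul_of_summable_norm (by simpa [Real.norm_of_nonneg (hn₁ _)] using hg₁.summable)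
      (by simpa [Real.norm_of_nonneg (hn₂ _)] using hg₂.summable))
  exact hprod.tsum_eq

/-- **The functional equation of the oscillating part** `Θ♯_z(1/t) = t Θ♯_z(t)`. [folklore] -/
theorem thetaNC_inv (z : ℍ) {t : ℝ} (ht : 0 < t) : thetaNC z (1 / t) = t * thetaNC z t := by
  unfold thetaNC thetaConst
  rw [thetaQ_functional_equation z ht, sqrt_mul_eq z.im ht]
  have e1 : z.im * (1 / t) = z.im / t := by ring
  have e2 : z.im / (1 / t) = z.im * t := by field_simp
  rw [e1, e2]
  push_cast
  ring

/-- `Θ♯_z` is continuous on `(0, ∞)`. [folklore] -/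
theorem continuousOn_thetaNC (z : ℍ) : ContinuousOn (thetaNC z) (Ioi 0) := by
  have hy := z.im_pos
  have hsq : ContinuousOn (fun t : ℝ => Real.sqrt (z.im / t)) (Ioi 0) :=
    Real.continuous_sqrt.comp_continuousOn (continuousOn_const.div continuousOn_id fun t ht => (mem_Ioi.mp ht).ne')
  have hθ1 : ContinuousOn (fun t : ℝ => thetaZ (z.im * t)) (Ioi 0) :=
    continuousOn_thetaZ.comp (Continuous.continuousOn (by fun_prop))
      fun t ht => mem_Ioi.mpr (mul_pos hy (mem_Ioi.mp ht))
  have hθ2 : ContinuousOn (fun t : ℝ => thetaZ (z.im / t)) (Ioi 0) :=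
    continuousOn_thetaZ.comp (continuousOn_const.div continuousOn_id fun t ht => (mem_Ioi.mp ht).ne')
      fun t ht => mem_Ioi.mpr (div_pos hy (mem_Ioi.mp ht))
  have hc : ContinuousOn (thetaConst z) (Ioi 0) := by
    unfold thetaConst
    exact hsq.mul ((hθ1.add hθ2).sub continuousOn_const)
  unfold thetaNC
  exact Complex.continuous_ofReal.comp_continuousOn ((continuousOn_thetaQ z).sub hc)

/-! ## 3. Decay of the oscillating part -/

/-- The `x`-independent majorant `M_y(t) = √(y/t)(θ(yt) - 1)(θ(y/t) - 1)` of `‖Θ♯_z(t)‖`. [folklore] -/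
def thetaNCBound (y t : ℝ) : ℝ := Real.sqrt (y / t) * ((thetaZ (y * t) - 1) * (thetaZ (y / t) - 1))

/-- `‖Θ♯_z(t)‖ ≤ M_y(t)`. [folklore] -/
theorem norm_thetaNC_le_thetaNCBound (z : ℍ) {t : ℝ} (ht : 0 < t) :
    ‖thetaNC z t‖ ≤ thetaNCBound z.im t := norm_thetaNC_le z ht

/-- The majorant is non-negative. [folklore] -/
theorem thetaNCBound_nonneg {y t : ℝ} (hy : 0 < y) (ht : 0 < t) : 0 ≤ thetaNCBound y t := by
  unfold thetaNCBound
  have h1 : 0 ≤ thetaZ (y * t) - 1 := by linarith [one_le_thetaZ (mul_pos hy ht)]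
  have h2 : 0 ≤ thetaZ (y / t) - 1 := by linarith [one_le_thetaZ (div_pos hy ht)]
  positivity

/-- `M_y(1/t) = t M_y(t)`. [folklore] -/
theorem thetaNCBound_inv {y t : ℝ} (ht : 0 < t) : thetaNCBound y (1 / t) = t * thetaNCBound y t := by
  unfold thetaNCBound
  rw [sqrt_mul_eq y ht]
  have e1 : y * (1 / t) = y / t := by ring
  have e2 : y / (1 / t) = y * t := by field_simp
  rw [e1, e2]; ring

/-- The constant `K(y) = e^{πy}(θ(y) - 1)θ(1/y)` of the decay estimate. [folklore] -/
def ncK (y : ℝ) : ℝ := Real.exp (π * y) * (thetaZ y - 1) * thetaZ (1 / y)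

/-- `K(y) ≥ 0`. [folklore] -/
theorem ncK_nonneg {y : ℝ} (hy : 0 < y) : 0 ≤ ncK y :=
  mul_nonneg (mul_nonneg (Real.exp_pos _).le (by linarith [one_le_thetaZ hy]))
    (thetaZ_pos (one_div_pos.mpr hy)).le

/-- **Decay at infinity**: `M_y(t) ≤ K(y) e^{-π y t}` for `t ≥ 1`. [folklore] -/
theorem thetaNCBound_le_of_one_le {y t : ℝ} (hy : 0 < y) (ht : 1 ≤ t) :
    thetaNCBound y t ≤ ncK y * Real.exp (-(π * y * t)) := by
  have htpos : 0 < t := one_pos.trans_le ht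
  have h1 : thetaZ (y * t) - 1 ≤ Real.exp (-(π * (y * t - y))) * (thetaZ y - 1) :=
    thetaZ_sub_one_le hy (by nlinarith)
  have h2 : thetaZ (y / t) - 1 ≤ Real.sqrt (t / y) * thetaZ (1 / y) := by
    have := thetaZ_div_le hy ht
    have h0 : 0 ≤ Real.sqrt (t / y) * thetaZ (1 / y) :=
      mul_nonneg (Real.sqrt_nonneg _) (thetaZ_pos (one_div_pos.mpr hy)).le
    linarith
  have h2' : 0 ≤ thetaZ (y / t) - 1 := by linarith [one_le_thetaZ (div_pos hy htpos)]
  have hθ : 0 ≤ thetaZ y - 1 := by linarith [one_le_thetaZ hy]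
  have hs : Real.sqrt (y / t) * Real.sqrt (t / y) = 1 := by
    rw [← Real.sqrt_mul (div_pos hy htpos).le, div_mul_div_comm, mul_comm y t,
      div_self (by positivity), Real.sqrt_one]
  have he : Real.exp (-(π * (y * t - y))) = Real.exp (π * y) * Real.exp (-(π * y * t)) := by
    rw [← Real.exp_add]; congr 1; ring
  unfold thetaNCBound ncK
  calc Real.sqrt (y / t) * ((thetaZ (y * t) - 1) * (thetaZ (y / t) - 1))
      ≤ Real.sqrt (y / t) * ((Real.exp (-(π * (y * t - y))) * (thetaZ y - 1)) *
          (Real.sqrt (t / y) * thetaZ (1 / y))) :=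
        mul_le_mul_of_nonneg_left (mul_le_mul h1 h2 h2' (mul_nonneg (Real.exp_pos _).le hθ))
          (Real.sqrt_nonneg _)
    _ = (Real.sqrt (y / t) * Real.sqrt (t / y)) * (Real.exp (π * y) * (thetaZ y - 1) * thetaZ (1 / y)) *
          Real.exp (-(π * y * t)) := by rw [he]; ring
    _ = Real.exp (π * y) * (thetaZ y - 1) * thetaZ (1 / y) * Real.exp (-(π * y * t)) := by
        rw [hs, one_mul]

/-- **Decay at zero**: `M_y(t) ≤ K(y) t⁻¹ e^{-π y/t}` for `0 < t ≤ 1`. [folklore] -/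
theorem thetaNCBound_le_of_le_one {y t : ℝ} (hy : 0 < y) (ht0 : 0 < t) (ht : t ≤ 1) :
    thetaNCBound y t ≤ ncK y * t⁻¹ * Real.exp (-(π * y / t)) := by
  have hu : 1 ≤ 1 / t := by rw [le_div_iff₀ ht0]; linarith
  have h := thetaNCBound_inv (y := y) (t := 1 / t) (by positivity)
  rw [one_div_one_div] at h
  rw [h]
  have hb := thetaNCBound_le_of_one_le hy hu
  calc 1 / t * thetaNCBound y (1 / t) ≤ 1 / t * (ncK y * Real.exp (-(π * y * (1 / t)))) :=
        mul_le_mul_of_nonneg_left hb (by positivity)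
    _ = ncK y * t⁻¹ * Real.exp (-(π * y / t)) := by
        have e : -(π * y * (1 / t)) = -(π * y / t) := by ring
        rw [e]; ring

/-- The absolute constant `K₁ = e^{π/2}(θ(1/2) - 1)θ(1/2)`. [folklore] -/
def ncK₁ : ℝ := Real.exp (π / 2) * (thetaZ (1 / 2) - 1) * thetaZ (1 / 2)

/-- `K₁ ≥ 0`. [folklore] -/
theorem ncK₁_nonneg : 0 ≤ ncK₁ :=
  mul_nonneg (mul_nonneg (Real.exp_pos _).le (by linarith [one_le_thetaZ (by norm_num : (0 : ℝ) < 1 / 2)]))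
    (thetaZ_pos (by norm_num)).le

/-- **In the cusp `K(y) ≤ K₁ √y`** (`y ≥ 1/2`). [folklore] -/
theorem ncK_le {y : ℝ} (hy : 1 / 2 ≤ y) : ncK y ≤ ncK₁ * Real.sqrt y := by
  have hy0 : 0 < y := by linarith
  have h1 : thetaZ y - 1 ≤ Real.exp (-(π * (y - 1 / 2))) * (thetaZ (1 / 2) - 1) :=
    thetaZ_sub_one_le (by norm_num) hy
  have h2 : thetaZ (1 / y) ≤ Real.sqrt y * thetaZ (1 / 2) := by
    rw [thetaZ_inv hy0]
    exact mul_le_mul_of_nonneg_left (thetaZ_antitoneOn (by norm_num : (1 / 2 : ℝ) ∈ Ioi 0) hy0 hy)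
      (Real.sqrt_nonneg _)
  have hθ : 0 ≤ thetaZ (1 / 2) - 1 := by linarith [one_le_thetaZ (by norm_num : (0 : ℝ) < 1 / 2)]
  unfold ncK ncK₁
  calc Real.exp (π * y) * (thetaZ y - 1) * thetaZ (1 / y)
      ≤ Real.exp (π * y) * (Real.exp (-(π * (y - 1 / 2))) * (thetaZ (1 / 2) - 1)) *
          (Real.sqrt y * thetaZ (1 / 2)) :=
        mul_le_mul (mul_le_mul_of_nonneg_left h1 (Real.exp_pos _).le) h2
          (thetaZ_pos (one_div_pos.mpr hy0)).le (by positivity)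
    _ = (Real.exp (π * y) * Real.exp (-(π * (y - 1 / 2)))) * (thetaZ (1 / 2) - 1) * thetaZ (1 / 2) *
          Real.sqrt y := by ring
    _ = Real.exp (π / 2) * (thetaZ (1 / 2) - 1) * thetaZ (1 / 2) * Real.sqrt y := by
        rw [← Real.exp_add]; congr 3; ring

/-- `Θ♯_z` and its majorant are `O(e^{-π y t})` at `∞`. [folklore] -/
theorem isBigO_thetaNCBound_atTop {y : ℝ} (hy : 0 < y) :
    (fun t => ((thetaNCBound y t : ℝ) : ℂ)) =O[atTop] fun t => Real.exp (-(π * y) * t) := by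
  refine Asymptotics.IsBigO.of_bound (ncK y) ?_
  filter_upwards [eventually_ge_atTop (1 : ℝ)] with t ht
  rw [Complex.norm_real, Real.norm_of_nonneg (thetaNCBound_nonneg hy (one_pos.trans_le ht)),
    Real.norm_of_nonneg (Real.exp_pos _).le]
  have := thetaNCBound_le_of_one_le hy ht
  rwa [neg_mul]

/-- `Θ♯_z(t) = O(e^{-πyt})` at `∞`. [folklore] -/
theorem isBigO_thetaNC_atTop (z : ℍ) : thetaNC z =O[atTop] fun t => Real.exp (-(π * z.im) * t) := by
  refine Asymptotics.IsBigO.trans ?_ (isBigO_thetaNCBound_atTop z.im_pos)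
  refine Asymptotics.IsBigO.of_bound 1 ?_
  filter_upwards [eventually_gt_atTop (0 : ℝ)] with t ht
  rw [one_mul, Complex.norm_real, Real.norm_of_nonneg (thetaNCBound_nonneg z.im_pos ht)]
  exact norm_thetaNC_le_thetaNCBound z ht

/-- `Θ♯_z` and its majorant are `O(t^{-b})` at `0` for every `b`. [folklore] -/
theorem isBigO_thetaNCBound_nhds_zero {y : ℝ} (hy : 0 < y) (b : ℝ) :
    (fun t => ((thetaNCBound y t : ℝ) : ℂ)) =O[𝓝[>] 0] (· ^ (-b)) := by
  set n : ℕ := ⌈1 - b⌉₊ with hn_def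
  have hn : 1 - b ≤ n := Nat.le_ceil _
  set C : ℝ := ncK y * (n.factorial / (π * y) ^ n) with hC
  have hC0 : 0 ≤ C := mul_nonneg (ncK_nonneg hy) (by positivity)
  refine Asymptotics.IsBigO.of_bound C ?_
  filter_upwards [Ioc_mem_nhdsGT (zero_lt_one' ℝ)] with t ht
  have ht0 := ht.1
  have ht1 := ht.2
  have h1 := thetaNCBound_le_of_le_one hy ht0 ht1
  have h2 : Real.exp (-(π * y / t)) ≤ n.factorial * t ^ n / (π * y) ^ n := by
    have hx : 0 ≤ π * y / t := by positivity
    have hfe := Real.pow_div_factorial_le_exp _ hx n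
    have hpos : 0 < (n.factorial : ℝ) * t ^ n / (π * y) ^ n := by positivity
    rw [Real.exp_neg, inv_le_comm₀ (Real.exp_pos _) hpos]
    calc ((n.factorial : ℝ) * t ^ n / (π * y) ^ n)⁻¹ = (π * y / t) ^ n / n.factorial := by
          rw [inv_div, div_pow]
          field_simp
      _ ≤ _ := hfe
  have h3 : t ^ n * t⁻¹ ≤ t ^ (-b) := by
    rw [← Real.rpow_natCast, ← Real.rpow_neg_one, ← Real.rpow_add ht0]
    exact Real.rpow_le_rpow_of_exponent_ge ht0 ht1 (by linarith)
  rw [Complex.norm_real, Real.norm_of_nonneg (thetaNCBound_nonneg hy ht0),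
    Real.norm_of_nonneg (Real.rpow_nonneg ht0.le _)]
  calc thetaNCBound y t ≤ ncK y * t⁻¹ * Real.exp (-(π * y / t)) := h1
    _ ≤ ncK y * t⁻¹ * (n.factorial * t ^ n / (π * y) ^ n) :=
        mul_le_mul_of_nonneg_left h2 (mul_nonneg (ncK_nonneg hy) (inv_pos.mpr ht0).le)
    _ = C * (t ^ n * t⁻¹) := by rw [hC]; ring
    _ ≤ C * t ^ (-b) := mul_le_mul_of_nonneg_left h3 hC0

/-- `Θ♯_z(t) = O(t^{-b})` at `0` for every `b`. [folklore] -/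
theorem isBigO_thetaNC_nhds_zero (z : ℍ) (b : ℝ) : thetaNC z =O[𝓝[>] 0] (· ^ (-b)) := by
  refine Asymptotics.IsBigO.trans ?_ (isBigO_thetaNCBound_nhds_zero z.im_pos b)
  refine Asymptotics.IsBigO.of_bound 1 ?_
  filter_upwards [self_mem_nhdsWithin] with t ht
  rw [one_mul, Complex.norm_real, Real.norm_of_nonneg (thetaNCBound_nonneg z.im_pos ht)]
  exact norm_thetaNC_le_thetaNCBound z ht

/-- Continuity of the majorant on `(0, ∞)`. [folklore] -/
theorem continuousOn_thetaNCBound {y : ℝ} (hy : 0 < y) : ContinuousOn (thetaNCBound y) (Ioi 0) := by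
  have hsq : ContinuousOn (fun t : ℝ => Real.sqrt (y / t)) (Ioi 0) :=
    Real.continuous_sqrt.comp_continuousOn (continuousOn_const.div continuousOn_id fun t ht => (mem_Ioi.mp ht).ne')
  have hθ1 : ContinuousOn (fun t : ℝ => thetaZ (y * t)) (Ioi 0) :=
    continuousOn_thetaZ.comp (Continuous.continuousOn (by fun_prop))
      fun t ht => mem_Ioi.mpr (mul_pos hy (mem_Ioi.mp ht))
  have hθ2 : ContinuousOn (fun t : ℝ => thetaZ (y / t)) (Ioi 0) :=
    continuousOn_thetaZ.comp (continuousOn_const.div continuousOn_id fun t ht => (mem_Ioi.mp ht).ne')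
      fun t ht => mem_Ioi.mpr (div_pos hy (mem_Ioi.mp ht))
  unfold thetaNCBound
  exact hsq.mul ((hθ1.sub continuousOn_const).mul (hθ2.sub continuousOn_const))

/-- **The Mellin transform of `Θ♯_z` converges everywhere**, and so does that of its majorant. [folklore] -/
theorem mellinConvergent_thetaNC (z : ℍ) (s : ℂ) : MellinConvergent (thetaNC z) s :=
  mellinConvergent_of_isBigO_rpow_exp (a := π * z.im) (b := s.re - 1) (by have := z.im_pos; positivity)
    ((continuousOn_thetaNC z).locallyIntegrableOn measurableSet_Ioi) (isBigO_thetaNC_atTop z)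
    (isBigO_thetaNC_nhds_zero z _) (by linarith)

/-- The Mellin transform of the majorant converges everywhere. [folklore] -/
theorem mellinConvergent_thetaNCBound {y : ℝ} (hy : 0 < y) (s : ℂ) :
    MellinConvergent (fun t => ((thetaNCBound y t : ℝ) : ℂ)) s :=
  mellinConvergent_of_isBigO_rpow_exp (a := π * y) (b := s.re - 1) (by positivity)
    ((Complex.continuous_ofReal.comp_continuousOn (continuousOn_thetaNCBound hy)).locallyIntegrableOn
      measurableSet_Ioi) (isBigO_thetaNCBound_atTop hy) (isBigO_thetaNCBound_nhds_zero hy _) (by linarith)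

/-! ## 4. The entire function `N(z, s)` -/

/-- **`N(z, s) = ½ ∫₀^∞ Θ♯_z(t) t^{s-1} dt`**, the non-constant-term part of `E*(z, s)`
(`θ(s)` times the `K`-Bessel series of (3.29)). [cite: Iwaniec2002, Thm 3.4 (3.29), PDF p. 47] -/
def eisN (z : ℍ) (s : ℂ) : ℂ := mellin (thetaNC z) s / 2

/-- **`N(z, ·)` is entire.** [cite: Iwaniec2002, Thm 3.4, PDF p. 47] -/
theorem differentiable_eisN (z : ℍ) : Differentiable ℂ (eisN z) := fun s =>
  (mellin_differentiableAt_of_isBigO_rpow_exp (a := π * z.im) (b := s.re - 1) (by have := z.im_pos; positivity)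
    ((continuousOn_thetaNC z).locallyIntegrableOn measurableSet_Ioi) (isBigO_thetaNC_atTop z)
    (isBigO_thetaNC_nhds_zero z _) (by linarith)).div_const 2

/-- The exponential-times-power integrals `∫₁^∞ e^{-c u} u^a du` bounding `N(z, s)` in the cusp. [folklore] -/
def expPowInt (c a : ℝ) : ℝ := ∫ u in Ioi (1 : ℝ), Real.exp (-(c * u)) * u ^ a

/-- `e^{-cu} u^a` is integrable on `(1, ∞)` for `c > 0`. [folklore] -/
theorem integrableOn_exp_mul_rpow {c : ℝ} (hc : 0 < c) (a : ℝ) :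
    IntegrableOn (fun u : ℝ => Real.exp (-(c * u)) * u ^ a) (Ioi 1) := by
  refine integrable_of_isBigO_exp_neg (b := c / 2) (by positivity) ?_ ?_
  · refine ContinuousOn.mul (Continuous.continuousOn (by fun_prop)) ?_
    exact continuousOn_id.rpow_const fun u hu => Or.inl (by have : (1 : ℝ) ≤ u := hu; positivity)
  · have h1 := (isLittleO_rpow_exp_pos_mul_atTop a (half_pos hc)).isBigO
    have h2 : (fun u : ℝ => Real.exp (-(c * u)) * u ^ a) =O[atTop]
        fun u => Real.exp (-(c * u)) * Real.exp (c / 2 * u) :=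
      (Asymptotics.isBigO_refl _ _).mul h1
    refine h2.trans (Asymptotics.IsBigO.of_bound 1 ?_)
    filter_upwards with u
    rw [← Real.exp_add, one_mul, Real.norm_of_nonneg (Real.exp_pos _).le, Real.norm_of_nonneg (Real.exp_pos _).le]
    exact Real.exp_le_exp.mpr (by linarith)

/-- `∫₁^∞ e^{-cu} u^a du ≥ 0`. [folklore] -/
theorem expPowInt_nonneg (c a : ℝ) : 0 ≤ expPowInt c a :=
  setIntegral_nonneg measurableSet_Ioi fun u hu => by
    have : (1 : ℝ) < u := hu
    positivity

/-- Monotonicity in the exponent (`u ≥ 1`). [folklore] -/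
theorem expPowInt_mono {c : ℝ} (hc : 0 < c) {a b : ℝ} (hab : a ≤ b) : expPowInt c a ≤ expPowInt c b := by
  refine setIntegral_mono_on (integrableOn_exp_mul_rpow hc a) (integrableOn_exp_mul_rpow hc b)
    measurableSet_Ioi fun u hu => ?_
  have hu1 : (1 : ℝ) < u := hu
  exact mul_le_mul_of_nonneg_left (Real.rpow_le_rpow_of_exponent_le hu1.le hab) (Real.exp_pos _).le

/-- Monotonicity in the rate: `∫₁^∞ e^{-cu} u^a ≤ e^{-(c - c₀)} ∫₁^∞ e^{-c₀ u} u^a` for `c ≥ c₀ > 0`. [folklore] -/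
theorem expPowInt_le_exp_mul {c₀ c : ℝ} (hc₀ : 0 < c₀) (hc : c₀ ≤ c) (a : ℝ) :
    expPowInt c a ≤ Real.exp (-(c - c₀)) * expPowInt c₀ a := by
  unfold expPowInt
  rw [← integral_const_mul]
  refine setIntegral_mono_on (integrableOn_exp_mul_rpow (hc₀.trans_le hc) a)
    ((integrableOn_exp_mul_rpow hc₀ a).const_mul _) measurableSet_Ioi fun u hu => ?_
  have hu1 : (1 : ℝ) < u := hu
  rw [← mul_assoc, ← Real.exp_add]
  refine mul_le_mul_of_nonneg_right (Real.exp_le_exp.mpr ?_) (by positivity)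
  nlinarith

/-- The change of variables `t = 1/u` on `(0, 1]`: `∫_{(0,1]} F(t) dt = ∫_{(1,∞)} F(u⁻¹) u⁻² du`. [folklore] -/
theorem setIntegral_Ioc_eq_setIntegral_Ioi_inv (F : ℝ → ℝ) :
    ∫ t in Ioc (0 : ℝ) 1, F t = ∫ u in Ioi (1 : ℝ), F u⁻¹ * (u ^ 2)⁻¹ := by
  have h := integral_comp_rpow_Ioi ((Ioc (0 : ℝ) 1).indicator F) (p := -1) (by norm_num)
  rw [setIntegral_indicator measurableSet_Ioc, show Ioi (0 : ℝ) ∩ Ioc 0 1 = Ioc 0 1 from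
    inter_eq_right.mpr Ioc_subset_Ioi_self] at h
  have hr : ∫ u in Ioi (1 : ℝ), F u⁻¹ * (u ^ 2)⁻¹ =
      ∫ u in Ioi (0 : ℝ), (Ici (1 : ℝ)).indicator (fun u => F u⁻¹ * (u ^ 2)⁻¹) u := by
    rw [setIntegral_indicator measurableSet_Ici, show Ioi (0 : ℝ) ∩ Ici 1 = Ici 1 from
      inter_eq_right.mpr fun x hx => mem_Ioi.mpr (lt_of_lt_of_le one_pos (mem_Ici.mp hx)),
      integral_Ici_eq_integral_Ioi]
  rw [← h, hr]
  refine setIntegral_congr_fun measurableSet_Ioi fun x hx => ?_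
  have hx0 : (0 : ℝ) < x := hx
  simp only [Real.rpow_neg_one]
  by_cases h1 : 1 ≤ x
  · have hmem : x⁻¹ ∈ Ioc (0 : ℝ) 1 := ⟨inv_pos.mpr hx0, inv_le_one_of_one_le₀ h1⟩
    rw [indicator_of_mem hmem, indicator_of_mem (mem_Ici.mpr h1), smul_eq_mul, abs_neg, abs_one, one_mul,
      show ((-1 : ℝ) - 1) = -2 by norm_num, Real.rpow_neg hx0.le, Real.rpow_two]
    ring
  · have hnot : x⁻¹ ∉ Ioc (0 : ℝ) 1 := fun hm => h1 ((inv_le_one₀ hx0).mp hm.2)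
    rw [indicator_of_notMem hnot, indicator_of_notMem (fun h => h1 (mem_Ici.mp h)), smul_zero]

/-- **The cusp bound for `N(z, s)`**:
`‖N(z, s)‖ ≤ ½ K(y) (∫₁^∞ e^{-πyu} u^{σ-1} du + ∫₁^∞ e^{-πyu} u^{-σ} du)`, uniformly in `Im s`. [folklore] -/
theorem norm_eisN_le (z : ℍ) (s : ℂ) :
    ‖eisN z s‖ ≤ ncK z.im / 2 * (expPowInt (π * z.im) (s.re - 1) + expPowInt (π * z.im) (-s.re)) := by
  have hy := z.im_pos
  set σ := s.re with hσ
  -- Step 1: `‖N‖ ≤ ½ ∫₀^∞ M_y(t) t^{σ-1} dt`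
  have hconv := mellinConvergent_thetaNCBound hy s
  have hint : IntegrableOn (fun t : ℝ => thetaNCBound z.im t * t ^ (σ - 1)) (Ioi 0) := by
    have h := hconv.norm
    refine (integrableOn_congr_fun (fun t ht => ?_) measurableSet_Ioi).mp h
    have ht : (0 : ℝ) < t := ht
    rw [norm_smul, Complex.norm_cpow_eq_rpow_re_of_pos ht, Complex.norm_real,
      Real.norm_of_nonneg (thetaNCBound_nonneg hy ht), Complex.sub_re, Complex.one_re, mul_comm]
  have h1 : ‖eisN z s‖ ≤ (∫ t in Ioi (0 : ℝ), thetaNCBound z.im t * t ^ (σ - 1)) / 2 := by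
    unfold eisN mellin
    rw [norm_div, Complex.norm_two]
    refine div_le_div_of_nonneg_right ?_ zero_le_two
    refine (norm_integral_le_integral_norm _).trans ?_
    refine setIntegral_mono_on (mellinConvergent_thetaNC z s).norm hint measurableSet_Ioi fun t ht => ?_
    have ht : (0 : ℝ) < t := ht
    rw [norm_smul, Complex.norm_cpow_eq_rpow_re_of_pos ht, Complex.sub_re, Complex.one_re, mul_comm]
    exact mul_le_mul_of_nonneg_right (norm_thetaNC_le_thetaNCBound z ht) (Real.rpow_nonneg ht.le _)
  -- Step 2: split at `t = 1` and substitute `t = 1/u` on `(0, 1]`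
  have hsplit : ∫ t in Ioi (0 : ℝ), thetaNCBound z.im t * t ^ (σ - 1) =
      (∫ t in Ioc (0 : ℝ) 1, thetaNCBound z.im t * t ^ (σ - 1)) +
        ∫ t in Ioi (1 : ℝ), thetaNCBound z.im t * t ^ (σ - 1) := by
    rw [← Ioc_union_Ioi_eq_Ioi zero_le_one, setIntegral_union (Ioc_disjoint_Ioi le_rfl) measurableSet_Ioi
      (hint.mono_set Ioc_subset_Ioi_self) (hint.mono_set (Ioi_subset_Ioi zero_le_one))]
  have hlow : ∫ t in Ioc (0 : ℝ) 1, thetaNCBound z.im t * t ^ (σ - 1) =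
      ∫ u in Ioi (1 : ℝ), thetaNCBound z.im u * u ^ (-σ) := by
    rw [setIntegral_Ioc_eq_setIntegral_Ioi_inv]
    refine setIntegral_congr_fun measurableSet_Ioi fun u hu => ?_
    have hu1 : (1 : ℝ) < u := hu
    have hu0 : (0 : ℝ) < u := one_pos.trans hu1
    have hfe := thetaNCBound_inv (y := z.im) hu0
    rw [one_div] at hfe
    rw [hfe, Real.inv_rpow hu0.le, ← Real.rpow_neg hu0.le, neg_sub]
    have e : u * (u ^ 2)⁻¹ * u ^ (1 - σ) = u ^ (-σ) := by
      rw [show u * (u ^ 2)⁻¹ = u ^ (-1 : ℝ) by rw [Real.rpow_neg_one]; field_simp,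
        ← Real.rpow_add hu0]
      congr 1; ring
    calc u * thetaNCBound z.im u * u ^ (1 - σ) * (u ^ 2)⁻¹
        = thetaNCBound z.im u * (u * (u ^ 2)⁻¹ * u ^ (1 - σ)) := by ring
      _ = thetaNCBound z.im u * u ^ (-σ) := by rw [e]
  -- Step 3: bound both tails by `K(y) ∫₁^∞ e^{-πyu} u^a`
  have htail : ∀ a : ℝ, ∫ u in Ioi (1 : ℝ), thetaNCBound z.im u * u ^ a ≤ ncK z.im * expPowInt (π * z.im) a := by
    intro a
    unfold expPowInt
    rw [← integral_const_mul]
    refine integral_mono_of_nonneg ?_ ((integrableOn_exp_mul_rpow (by positivity) a).const_mul _) ?_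
    · filter_upwards [ae_restrict_mem measurableSet_Ioi] with u hu
      have hu1 : (1 : ℝ) < u := hu
      exact mul_nonneg (thetaNCBound_nonneg hy (one_pos.trans hu1)) (Real.rpow_nonneg (by linarith) _)
    · filter_upwards [ae_restrict_mem measurableSet_Ioi] with u hu
      have hu1 : (1 : ℝ) < u := hu
      have hb := thetaNCBound_le_of_one_le hy hu1.le
      calc thetaNCBound z.im u * u ^ a ≤ ncK z.im * Real.exp (-(π * z.im * u)) * u ^ a :=
            mul_le_mul_of_nonneg_right hb (Real.rpow_nonneg (by linarith) _)
        _ = ncK z.im * (Real.exp (-(π * z.im * u)) * u ^ a) := by ring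
  calc ‖eisN z s‖ ≤ (∫ t in Ioi (0 : ℝ), thetaNCBound z.im t * t ^ (σ - 1)) / 2 := h1
    _ = ((∫ u in Ioi (1 : ℝ), thetaNCBound z.im u * u ^ (-σ)) +
          ∫ t in Ioi (1 : ℝ), thetaNCBound z.im t * t ^ (σ - 1)) / 2 := by rw [hsplit, hlow]
    _ ≤ (ncK z.im * expPowInt (π * z.im) (-σ) + ncK z.im * expPowInt (π * z.im) (σ - 1)) / 2 := by
        gcongr <;> exact htail _
    _ = ncK z.im / 2 * (expPowInt (π * z.im) (σ - 1) + expPowInt (π * z.im) (-σ)) := by ring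

/-- **`N(z, s)` is exponentially small in the cusp, uniformly in vertical strips**: for `y ≥ 1/2` and
`σ₁ ≤ Re s ≤ σ₂`,
`‖N(z, s)‖ ≤ (K₁/2)(∫₁^∞ e^{-πu/2} u^{σ₂-1} du + ∫₁^∞ e^{-πu/2} u^{-σ₁} du) · √y · e^{-π(y - 1/2)}`.
[cite: Iwaniec2002, (3.20) & Thm 3.4, PDF pp. 45–47] -/
theorem norm_eisN_le_of_half_le (z : ℍ) (hz : 1 / 2 ≤ z.im) {σ₁ σ₂ : ℝ} {s : ℂ} (h₁ : σ₁ ≤ s.re) (h₂ : s.re ≤ σ₂) :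
    ‖eisN z s‖ ≤ ncK₁ / 2 * (expPowInt (π / 2) (σ₂ - 1) + expPowInt (π / 2) (-σ₁)) * Real.sqrt z.im *
      Real.exp (-(π * (z.im - 1 / 2))) := by
  have hy := z.im_pos
  have hπ : 0 < π / 2 := by positivity
  have hc : π / 2 ≤ π * z.im := by nlinarith [Real.pi_pos]
  have hK := ncK_le hz
  have hE : ∀ a : ℝ, expPowInt (π * z.im) a ≤ Real.exp (-(π * (z.im - 1 / 2))) * expPowInt (π / 2) a := by
    intro a
    have := expPowInt_le_exp_mul hπ hc a
    have e : -(π * z.im - π / 2) = -(π * (z.im - 1 / 2)) := by ring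
    rwa [e] at this
  have hm1 : expPowInt (π / 2) (s.re - 1) ≤ expPowInt (π / 2) (σ₂ - 1) := expPowInt_mono hπ (by linarith)
  have hm2 : expPowInt (π / 2) (-s.re) ≤ expPowInt (π / 2) (-σ₁) := expPowInt_mono hπ (by linarith)
  have hex := Real.exp_pos (-(π * (z.im - 1 / 2)))
  set I₁ := expPowInt (π / 2) (σ₂ - 1)
  set I₂ := expPowInt (π / 2) (-σ₁)
  have hI₁ : 0 ≤ I₁ := expPowInt_nonneg _ _
  have hI₂ : 0 ≤ I₂ := expPowInt_nonneg _ _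
  calc ‖eisN z s‖ ≤ ncK z.im / 2 * (expPowInt (π * z.im) (s.re - 1) + expPowInt (π * z.im) (-s.re)) :=
        norm_eisN_le z s
    _ ≤ (ncK₁ * Real.sqrt z.im) / 2 * (Real.exp (-(π * (z.im - 1 / 2))) * I₁ +
          Real.exp (-(π * (z.im - 1 / 2))) * I₂) := by
        apply mul_le_mul
        · linarith
        · exact add_le_add ((hE _).trans (mul_le_mul_of_nonneg_left hm1 hex.le))
            ((hE _).trans (mul_le_mul_of_nonneg_left hm2 hex.le))
        · exact add_nonneg (expPowInt_nonneg _ _) (expPowInt_nonneg _ _)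
        · have := ncK₁_nonneg; positivity
    _ = ncK₁ / 2 * (I₁ + I₂) * Real.sqrt z.im * Real.exp (-(π * (z.im - 1 / 2))) := by ring

/-! ## 5. The horizontal means of `Θ♯` and of `N(z, s)` vanish -/

/-- `Θ⁰` depends on `z` only through `Im z`. [folklore] -/
theorem thetaConst_pt {x y : ℝ} (hy : 0 < y) (t : ℝ) :
    thetaConst (pt x y) t = Real.sqrt (y / t) * (thetaZ (y * t) + thetaZ (y / t) - 1) := by
  unfold thetaConst; rw [pt_im hy]

/-- `Θ⁰_z` is continuous on `(0, ∞)`. [folklore] -/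
theorem continuousOn_thetaConst (z : ℍ) : ContinuousOn (thetaConst z) (Ioi 0) := by
  have hy := z.im_pos
  have hsq : ContinuousOn (fun t : ℝ => Real.sqrt (z.im / t)) (Ioi 0) :=
    Real.continuous_sqrt.comp_continuousOn (continuousOn_const.div continuousOn_id fun t ht => (mem_Ioi.mp ht).ne')
  have hθ1 : ContinuousOn (fun t : ℝ => thetaZ (z.im * t)) (Ioi 0) :=
    continuousOn_thetaZ.comp (Continuous.continuousOn (by fun_prop))
      fun t ht => mem_Ioi.mpr (mul_pos hy (mem_Ioi.mp ht))
  have hθ2 : ContinuousOn (fun t : ℝ => thetaZ (z.im / t)) (Ioi 0) :=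
    continuousOn_thetaZ.comp (continuousOn_const.div continuousOn_id fun t ht => (mem_Ioi.mp ht).ne')
      fun t ht => mem_Ioi.mpr (div_pos hy (mem_Ioi.mp ht))
  unfold thetaConst
  exact hsq.mul ((hθ1.add hθ2).sub continuousOn_const)

/-- Joint continuity of `(x, t) ↦ Θ♯_{x+iy}(t)` on `ℝ × (0, ∞)`. [folklore] -/
theorem continuousOn_thetaNC_pt {y : ℝ} (hy : 0 < y) :
    ContinuousOn (fun q : ℝ × ℝ => thetaNC (pt q.1 y) q.2) (univ ×ˢ Ioi 0) := by
  have hQ : ContinuousOn (fun q : ℝ × ℝ => thetaQ (pt q.1 y) q.2) (univ ×ˢ Ioi 0) := by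
    intro q hq
    have ht : 0 < q.2 := hq.2
    have h1 := continuousAt_thetaQ (pt q.1 y) ht
    have h2 : Continuous fun q : ℝ × ℝ => (pt q.1 y, q.2) :=
      ((continuous_pt hy).comp continuous_fst).prodMk continuous_snd
    have h3 : ContinuousAt ((fun p : ℍ × ℝ => thetaQ p.1 p.2) ∘ fun q : ℝ × ℝ => (pt q.1 y, q.2)) q :=
      ContinuousAt.comp (f := fun q : ℝ × ℝ => (pt q.1 y, q.2)) h1 h2.continuousAt
    exact h3.continuousWithinAt
  have hC : ContinuousOn (fun q : ℝ × ℝ => thetaConst (pt q.1 y) q.2) (univ ×ˢ Ioi 0) := by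
    have e : (fun q : ℝ × ℝ => thetaConst (pt q.1 y) q.2) = fun q => thetaConst (pt 0 y) q.2 := by
      funext q; rw [thetaConst_pt hy, thetaConst_pt hy]
    rw [e]
    exact (continuousOn_thetaConst (pt 0 y)).comp continuous_snd.continuousOn fun q hq => hq.2
  unfold thetaNC
  exact Complex.continuous_ofReal.comp_continuousOn (hQ.sub hC)

/-- The oscillating terms along a horocycle: `ncTerm (x+iy) t (m,k) = A_{m,k}(y,t) e(-x m k)`. [folklore] -/
theorem ncTerm_pt {x y : ℝ} (hy : 0 < y) (t : ℝ) (p : ℤ × ℤ) :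
    ncTerm (pt x y) t p = if p.1 = 0 ∨ p.2 = 0 then 0 else
      ((Real.exp (-(π * y * t * (p.1 : ℝ) ^ 2)) * Real.exp (-(π * y / t * (p.2 : ℝ) ^ 2)) : ℝ) : ℂ) *
        Complex.exp ((-(2 * π * (p.1 : ℂ) * (p.2 : ℂ)) * Complex.I) * x) := by
  unfold ncTerm dTerm
  rw [pt_im hy, pt_re hy]
  split_ifs
  · rfl
  · push_cast
    congr 1
    ring_nf

/-- The modulus of an oscillating term does not depend on `x`. [folklore] -/
theorem norm_ncTerm_pt {x y : ℝ} (hy : 0 < y) (t : ℝ) (p : ℤ × ℤ) :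
    ‖ncTerm (pt x y) t p‖ = ‖ncTerm (pt 0 y) t p‖ := by
  rw [norm_ncTerm, norm_ncTerm, pt_im hy, pt_im hy]

/-- `∫₀¹ e(-x n) dx = 0` for a non-zero integer `n`, on `Ico 0 1`. [folklore] -/
theorem setIntegral_Ico_exp_int (n : ℤ) (hn : n ≠ 0) :
    ∫ x in Ico (0 : ℝ) 1, Complex.exp ((-(2 * π * (n : ℂ))) * Complex.I * x) = 0 := by
  set c : ℂ := (-(2 * π * (n : ℂ))) * Complex.I with hc
  have hc0 : c ≠ 0 := by
    rw [hc]
    refine mul_ne_zero (neg_ne_zero.mpr (mul_ne_zero (mul_ne_zero two_ne_zero ?_) ?_)) Complex.I_ne_zero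
    · exact_mod_cast Real.pi_pos.ne'
    · exact_mod_cast hn
  rw [integral_Ico_eq_integral_Ioo, ← integral_Ioc_eq_integral_Ioo, ← intervalIntegral.integral_of_le zero_le_one]
  have h := integral_exp_mul_complex (a := 0) (b := 1) hc0
  simp only [Complex.ofReal_one, mul_one, Complex.ofReal_zero, mul_zero, Complex.exp_zero] at h
  have h1 : Complex.exp c = 1 := by
    rw [hc, show (-(2 * π * (n : ℂ))) * Complex.I = ((-n : ℤ) : ℂ) * (2 * π * Complex.I) by push_cast; ring]
    exact Complex.exp_int_mul_two_pi_mul_I _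
  have e : (fun x : ℝ => Complex.exp ((-(2 * π * (n : ℂ))) * Complex.I * x)) = fun x : ℝ => Complex.exp (c * x) := by
    funext x; rw [hc]
  rw [e, h, h1, sub_self, zero_div]

/-- Each oscillating term has horizontal mean zero. [folklore] -/
theorem setIntegral_Ico_ncTerm_pt {y : ℝ} (hy : 0 < y) (t : ℝ) (p : ℤ × ℤ) :
    ∫ x in Ico (0 : ℝ) 1, ncTerm (pt x y) t p = 0 := by
  simp_rw [ncTerm_pt hy]
  split_ifs with h
  · simp
  · push Not at h
    rw [integral_const_mul]
    have hmk : p.1 * p.2 ≠ 0 := mul_ne_zero h.1 h.2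
    have := setIntegral_Ico_exp_int (p.1 * p.2) hmk
    push_cast at this
    have e : (fun x : ℝ => Complex.exp (-(2 * π * (p.1 : ℂ) * (p.2 : ℂ)) * Complex.I * x)) =
        fun x : ℝ => Complex.exp (-(2 * π * ((p.1 : ℂ) * (p.2 : ℂ))) * Complex.I * x) := by
      funext x; ring_nf
    rw [e, this, mul_zero]

/-- **The horizontal mean of `Θ♯` vanishes**: `∫₀¹ Θ♯_{x+iy}(t) dx = 0`. [cite: Iwaniec2002, (3.20), PDF p. 45] -/
theorem setIntegral_Ico_thetaNC_pt {y : ℝ} (hy : 0 < y) {t : ℝ} (ht : 0 < t) :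
    ∫ x in Ico (0 : ℝ) 1, thetaNC (pt x y) t = 0 := by
  have hrep : ∀ x : ℝ, thetaNC (pt x y) t = (Real.sqrt (y / t) : ℂ) * ∑' p : ℤ × ℤ, ncTerm (pt x y) t p := by
    intro x
    rw [thetaNC_eq_sqrt_mul_tsum (pt x y) ht, pt_im hy]
  simp_rw [hrep]
  rw [integral_const_mul]
  have hint : ∀ p : ℤ × ℤ, Integrable (fun x : ℝ => ncTerm (pt x y) t p) (volume.restrict (Ico (0 : ℝ) 1)) := by
    intro p
    have hc : Continuous fun x : ℝ => ncTerm (pt x y) t p := by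
      simp_rw [ncTerm_pt hy]
      split_ifs
      · exact continuous_const
      · fun_prop
    exact (hc.integrableOn_Icc (a := 0) (b := 1)).mono_set Ico_subset_Icc_self
  have hsum : Summable fun p : ℤ × ℤ => ∫ x in Ico (0 : ℝ) 1, ‖ncTerm (pt x y) t p‖ := by
    have e : (fun p : ℤ × ℤ => ∫ x in Ico (0 : ℝ) 1, ‖ncTerm (pt x y) t p‖) = fun p => ‖ncTerm (pt 0 y) t p‖ := by
      funext p
      simp_rw [norm_ncTerm_pt hy t p]
      rw [setIntegral_const]
      simp [measureReal_def, Real.volume_Ico]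
    rw [e]
    exact summable_norm_ncTerm (pt 0 y) ht
  rw [← integral_tsum_of_summable_integral_norm hint hsum]
  simp_rw [setIntegral_Ico_ncTerm_pt hy]
  rw [tsum_zero, mul_zero]

/-- Lebesgue measure restricted to `[0, 1)` is finite. [folklore] -/
theorem isFiniteMeasure_restrict_Ico : IsFiniteMeasure (volume.restrict (Ico (0 : ℝ) 1)) :=
  isFiniteMeasure_restrict.mpr (by simp [Real.volume_Ico])

/-- **The horizontal mean of `N(z, s)` vanishes**: `∫₀¹ N(x + iy, s) dx = 0`. [cite: Iwaniec2002, Thm 3.4 (3.29), PDF p. 47] -/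
theorem setIntegral_Ico_eisN_pt {y : ℝ} (hy : 0 < y) (s : ℂ) :
    ∫ x in Ico (0 : ℝ) 1, eisN (pt x y) s = 0 := by
  haveI := isFiniteMeasure_restrict_Ico
  set G : ℝ → ℝ → ℂ := fun x t => ((t : ℂ) ^ (s - 1)) • thetaNC (pt x y) t with hG
  -- integrability of `G` on `[0,1) × (0,∞)`
  have hmaj : Integrable (fun t : ℝ => t ^ (s.re - 1) * thetaNCBound y t) (volume.restrict (Ioi (0 : ℝ))) := by
    have h := (mellinConvergent_thetaNCBound hy s).norm
    refine (integrableOn_congr_fun (fun t ht => ?_) measurableSet_Ioi).mp h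
    have ht : (0 : ℝ) < t := ht
    rw [norm_smul, Complex.norm_cpow_eq_rpow_re_of_pos ht, Complex.norm_real,
      Real.norm_of_nonneg (thetaNCBound_nonneg hy ht), Complex.sub_re, Complex.one_re]
  have hGm : AEStronglyMeasurable (Function.uncurry G)
      ((volume.restrict (Ico (0 : ℝ) 1)).prod (volume.restrict (Ioi (0 : ℝ)))) := by
    rw [Measure.prod_restrict, ← Measure.volume_eq_prod]
    refine ContinuousOn.aestronglyMeasurable ?_ (measurableSet_Ico.prod measurableSet_Ioi)
    have h1 : ContinuousOn (fun q : ℝ × ℝ => ((q.2 : ℂ) ^ (s - 1))) (Ico (0 : ℝ) 1 ×ˢ Ioi 0) := by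
      intro q hq
      have hq2 : (0 : ℝ) < q.2 := hq.2
      refine ContinuousAt.continuousWithinAt ?_
      refine (Complex.continuousAt_ofReal_cpow_const _ _ (Or.inr hq2.ne')).comp continuous_snd.continuousAt
    have h2 := (continuousOn_thetaNC_pt hy).mono (show Ico (0 : ℝ) 1 ×ˢ Ioi (0 : ℝ) ⊆ univ ×ˢ Ioi 0 from
      prod_mono (subset_univ _) le_rfl)
    exact h1.smul h2
  have hGi : Integrable (Function.uncurry G) ((volume.restrict (Ico (0 : ℝ) 1)).prod (volume.restrict (Ioi (0 : ℝ)))) := by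
    refine Integrable.mono' (hmaj.comp_snd (volume.restrict (Ico (0 : ℝ) 1))) hGm ?_
    rw [Measure.prod_restrict, ← Measure.volume_eq_prod]
    filter_upwards [ae_restrict_mem (measurableSet_Ico.prod measurableSet_Ioi)] with q hq
    have hq2 : (0 : ℝ) < q.2 := hq.2
    simp only [Function.uncurry, hG]
    rw [norm_smul, Complex.norm_cpow_eq_rpow_re_of_pos hq2, Complex.sub_re, Complex.one_re]
    have hb := norm_thetaNC_le_thetaNCBound (pt q.1 y) hq2
    rw [pt_im hy] at hb
    exact mul_le_mul_of_nonneg_left hb (Real.rpow_nonneg hq2.le _)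
  have hswap := integral_integral_swap hGi
  -- the inner `x`-integral vanishes for every `t > 0`
  have hinner : ∀ t ∈ Ioi (0 : ℝ), ∫ x in Ico (0 : ℝ) 1, G x t = 0 := by
    intro t ht
    have ht' : (0 : ℝ) < t := ht
    simp only [hG]
    rw [integral_smul, setIntegral_Ico_thetaNC_pt hy ht', smul_zero]
  have hrhs : ∫ t in Ioi (0 : ℝ), ∫ x in Ico (0 : ℝ) 1, G x t = 0 := by
    rw [setIntegral_congr_fun measurableSet_Ioi hinner, integral_zero]
  unfold eisN mellin
  rw [integral_div]
  simp only [hG] at hswap hrhs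
  rw [hswap, hrhs, zero_div]

end Literature.NumberTheory.Automorphic

end
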